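import Mathlib

/-!
# Weighted Aztec diamonds: vertices, edges, cells, perfect matchings as edge sets

Coordinates for the Aztec diamond graph `A_m` of order `m` (Propp 2003, *Generalized domino-shuffling*,
§1.1 and §2): the `m²` cells of the level-`m` cell decomposition are indexed by `Cell m = Fin m × Fin m`;
every edge lies in exactly one cell and joins the cell's "horizontal" corner `δ ∈ Fin 2` (`0 = W`, `1 = E`)
to its "vertical" corner `ε ∈ Fin 2` (`0 = S`, `1 = N`), so `E m = Cell m × (Fin 2 × Fin 2)`; the vertices
are `V m = (Fin (m+1) × Fin m) ⊕ (Fin m × Fin (m+1))` (W/E-type corners, S/N-type corners), the edge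
`((p,q),(δ,ε))` joining `inl (p+δ, q)` to `inr (p, q+ε)`.  A perfect matching of a vertex set `U` is a
set of edges `M` in which every vertex of `U` has degree `1` and every other vertex degree `0`; the
dimer partition function `Z U ew` is the sum over such `M` of the product of the edge weights.  Main
result here: `isPM_iff` — perfect matchings are the edge sets whose cell slices are local (matchings of
the 4-cycle) with consistent boundary types. [cite: Propp2003, §2 and §5]

All `def … : Prop` declarations in this file are decidable predicates on finite data (not named facts).
Support file for `SquareGridDimersDivisionEasy` (route DivisionGap, item stmt-ValiantsHypothesis-5072);
the closing theorem is `squareGridDimersDivisionEasy_proof` in `…DivisionGapSquareGridDimersDivisionEasy.lean`.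
-/

namespace Summit.ValiantsHypothesis.ValiantsHypothesis.Theorems

namespace SquareGridDimers

set_option linter.dupNamespace false

noncomputable section

open Finset


/-! ## Vertices, edges, cells -/

/-- Cells of the level-`m` decomposition of the Aztec diamond of order `m`. [cite: Propp2003, §2] -/
abbrev Cell (m : ℕ) : Type := Fin m × Fin m

/-- Position of an edge inside its cell: (horizontal corner `δ`, vertical corner `ε`). [cite: Propp2003, §2] -/
abbrev Pos : Type := Fin 2 × Fin 2

/-- Edges of the Aztec diamond of order `m`: a cell and a position in it. [cite: Propp2003, §2] -/
abbrev E (m : ℕ) : Type := Cell m × Pos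

/-- Vertices of the Aztec diamond of order `m`: W/E-type corners `inl (x, y)` and S/N-type corners
`inr (p, y')`. [cite: Propp2003, §1.1] -/
abbrev V (m : ℕ) : Type := (Fin (m + 1) × Fin m) ⊕ (Fin m × Fin (m + 1))

/-- The horizontal (W/E-type) endpoint of an edge. [cite: Propp2003, §2] -/
def hEnd {m : ℕ} (e : E m) : V m :=
  Sum.inl (⟨e.1.1.val + e.2.1.val, by omega⟩, e.1.2)

/-- The vertical (S/N-type) endpoint of an edge. [cite: Propp2003, §2] -/
def vEnd {m : ℕ} (e : E m) : V m :=
  Sum.inr (e.1.1, ⟨e.1.2.val + e.2.2.val, by omega⟩)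

/-- Incidence of an edge and a vertex. [folklore] -/
def Inc {m : ℕ} (e : E m) (v : V m) : Prop := hEnd e = v ∨ vEnd e = v

/-- Incidence is decidable. [folklore] -/
instance {m : ℕ} (e : E m) (v : V m) : Decidable (Inc e v) := by unfold Inc; infer_instance

/-- Degree of a vertex in an edge set. [folklore] -/
def deg {m : ℕ} (M : Finset (E m)) (v : V m) : ℕ := (M.filter (fun e => Inc e v)).card

/-- `M` is a perfect matching of the vertex set `U`: degree `1` on `U`, degree `0` elsewhere. [folklore] -/
def IsPM {m : ℕ} (U : Finset (V m)) (M : Finset (E m)) : Prop :=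
  ∀ v, deg M v = if v ∈ U then 1 else 0

/-- Being a perfect matching is decidable. [folklore] -/
instance {m : ℕ} (U : Finset (V m)) (M : Finset (E m)) : Decidable (IsPM U M) := by
  unfold IsPM; infer_instance

/-- The finite set of perfect matchings of `U`. [folklore] -/
def pmSet {m : ℕ} (U : Finset (V m)) : Finset (Finset (E m)) := univ.filter (IsPM U)

/-- The dimer partition function of the vertex set `U` with edge weights `ew`: the sum over perfect
matchings of `U` of the product of the weights of their edges. [cite: Propp2003, §2] -/
def Z {m : ℕ} {F : Type*} [CommSemiring F] (U : Finset (V m)) (ew : E m → F) : F :=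
  ∑ M ∈ pmSet U, ∏ e ∈ M, ew e

/-- Membership in `pmSet`. [folklore] -/
theorem mem_pmSet {m : ℕ} {U : Finset (V m)} {M : Finset (E m)} : M ∈ pmSet U ↔ IsPM U M := by
  simp [pmSet]

/-! ## Slicing an edge set by cells -/

/-- The slice of an edge set at a cell: the set of positions it occupies there. [folklore] -/
def slice {m : ℕ} (M : Finset (E m)) (c : Cell m) : Finset Pos :=
  M.preimage (Prod.mk c) (by intro a _ b _ h; exact (Prod.mk.injEq _ _ _ _ ▸ h :).2)

/-- Glue a family of slices back into an edge set. [folklore] -/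
def glue {m : ℕ} (g : Cell m → Finset Pos) : Finset (E m) := univ.filter (fun e => e.2 ∈ g e.1)

/-- Membership in a slice. [folklore] -/
@[simp] theorem mem_slice {m : ℕ} (M : Finset (E m)) (c : Cell m) (p : Pos) :
    p ∈ slice M c ↔ (c, p) ∈ M := by
  simp [slice]

/-- Membership in a glued edge set. [folklore] -/
@[simp] theorem mem_glue {m : ℕ} (g : Cell m → Finset Pos) (e : E m) : e ∈ glue g ↔ e.2 ∈ g e.1 := by
  simp [glue]

/-- Slicing after gluing is the identity. [folklore] -/
@[simp] theorem slice_glue {m : ℕ} (g : Cell m → Finset Pos) : slice (glue g) = g := by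
  funext c; ext p; simp

/-- Gluing the slices gives back the edge set. [folklore] -/
@[simp] theorem glue_slice {m : ℕ} (M : Finset (E m)) : glue (slice M) = M := by
  ext ⟨c, p⟩; simp

/-- Edge sets are the same as families of slices. [folklore] -/
def sliceEquiv (m : ℕ) : Finset (E m) ≃ (Cell m → Finset Pos) where
  toFun := slice
  invFun := glue
  left_inv := glue_slice
  right_inv := slice_glue

/-- The product of edge weights over an edge set, cell by cell. [folklore] -/
theorem prod_eq_prod_slice {m : ℕ} {F : Type*} [CommSemiring F] (M : Finset (E m)) (ew : E m → F) :
    ∏ e ∈ M, ew e = ∏ c : Cell m, ∏ p ∈ slice M c, ew (c, p) := by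
  classical
  have h : M = (univ ×ˢ (univ : Finset Pos)).filter (fun e => e ∈ M) := by
    ext e; simp
  conv_lhs => rw [h]
  rw [prod_filter, prod_product]
  refine prod_congr rfl fun c _ => ?_
  rw [← prod_filter]
  refine prod_congr ?_ fun _ _ => rfl
  ext p; simp


/-! ## Local patterns and boundary types -/

/-- A local pattern (set of positions inside one cell) is *local* (a matching of the 4-cycle) if no two
of its edges share a horizontal or a vertical corner. [folklore] -/
def IsLocal (P : Finset Pos) : Prop :=
  (P.image Prod.fst).card = P.card ∧ (P.image Prod.snd).card = P.card

/-- Locality is decidable. [folklore] -/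
instance (P : Finset Pos) : Decidable (IsLocal P) := by unfold IsLocal; infer_instance

/-- A pattern is local iff both corner projections are injective on it. [folklore] -/
theorem isLocal_iff (P : Finset Pos) :
    IsLocal P ↔ Set.InjOn Prod.fst (P : Set Pos) ∧ Set.InjOn Prod.snd (P : Set Pos) := by
  rw [IsLocal, card_image_iff, card_image_iff]

/-- Boundary types of a cell: the sets of horizontal and of vertical corners used. [cite: Propp2003, §5] -/
abbrev BType : Type := Finset (Fin 2) × Finset (Fin 2)

/-- The boundary type of a local pattern: which corners of the cell it covers. [cite: Propp2003, §5] -/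
def btype (P : Finset Pos) : BType := (P.image Prod.fst, P.image Prod.snd)

/-- The degree of a vertex computed from boundary types only ("boundary degree"). [folklore] -/
def bdeg {m : ℕ} (τ : Cell m → BType) : V m → ℕ
  | Sum.inl (x, y) => ∑ p : Fin m, ∑ δ : Fin 2, if p.val + δ.val = x.val ∧ δ ∈ (τ (p, y)).1 then 1 else 0
  | Sum.inr (p, y) => ∑ q : Fin m, ∑ ε : Fin 2, if q.val + ε.val = y.val ∧ ε ∈ (τ (p, q)).2 then 1 else 0

/-- Consistency of a family of boundary types with a vertex set `U`: boundary degree `1` on `U` and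
`0` elsewhere. [folklore] -/
def Cons {m : ℕ} (U : Finset (V m)) (τ : Cell m → BType) : Prop :=
  ∀ v, bdeg τ v = if v ∈ U then 1 else 0

/-- Consistency is decidable. [folklore] -/
instance {m : ℕ} (U : Finset (V m)) (τ : Cell m → BType) : Decidable (Cons U τ) := by
  unfold Cons; infer_instance

/-- When the horizontal endpoint is a given W/E-type vertex. [folklore] -/
theorem hEnd_eq_inl_iff {m : ℕ} (e : E m) (x : Fin (m + 1)) (y : Fin m) :
    hEnd e = Sum.inl (x, y) ↔ e.1.1.val + e.2.1.val = x.val ∧ e.1.2 = y := by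
  simp [hEnd, Prod.ext_iff, Fin.ext_iff]

/-- When the vertical endpoint is a given S/N-type vertex. [folklore] -/
theorem vEnd_eq_inr_iff {m : ℕ} (e : E m) (p : Fin m) (y : Fin (m + 1)) :
    vEnd e = Sum.inr (p, y) ↔ e.1.1 = p ∧ e.1.2.val + e.2.2.val = y.val := by
  simp [vEnd, Prod.ext_iff, Fin.ext_iff]

/-- Horizontal endpoints are never S/N-type vertices. [folklore] -/
@[simp] theorem hEnd_ne_inr {m : ℕ} (e : E m) (w : Fin m × Fin (m + 1)) : hEnd e ≠ Sum.inr w := by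
  simp [hEnd]

/-- Vertical endpoints are never W/E-type vertices. [folklore] -/
@[simp] theorem vEnd_ne_inl {m : ℕ} (e : E m) (w : Fin (m + 1) × Fin m) : vEnd e ≠ Sum.inl w := by
  simp [vEnd]

/-- The degree of a vertex as a sum of indicators over all edges. [folklore] -/
theorem deg_eq_sum {m : ℕ} (M : Finset (E m)) (v : V m) :
    deg M v = ∑ e : E m, if e ∈ M ∧ Inc e v then 1 else 0 := by
  classical
  unfold deg
  rw [card_filter, ← sum_filter, ← sum_filter]
  congr 1
  ext e; simp

/-- The degree of a W/E-type vertex, slice by slice. [folklore] -/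
theorem deg_inl {m : ℕ} (M : Finset (E m)) (x : Fin (m + 1)) (y : Fin m) :
    deg M (Sum.inl (x, y)) =
      ∑ p : Fin m, ∑ δ : Fin 2, if p.val + δ.val = x.val then
        ∑ ε : Fin 2, (if (δ, ε) ∈ slice M (p, y) then 1 else 0) else 0 := by
  classical
  rw [deg_eq_sum, Fintype.sum_prod_type, Fintype.sum_prod_type]
  refine sum_congr rfl fun p _ => ?_
  simp only [Inc, vEnd_ne_inl, or_false, hEnd_eq_inl_iff, Fintype.sum_prod_type, mem_slice]
  rw [sum_comm]
  refine sum_congr rfl fun δ _ => ?_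
  split_ifs with h
  · rw [sum_comm]
    refine sum_congr rfl fun ε _ => ?_
    simp only [h, true_and]
    rw [show (∑ q : Fin m, if ((p, q), (δ, ε)) ∈ M ∧ q = y then (1 : ℕ) else 0)
        = ∑ q : Fin m, if q = y then (if ((p, q), (δ, ε)) ∈ M then 1 else 0) else 0 from
        sum_congr rfl fun q _ => by split_ifs <;> simp_all]
    rw [sum_ite_eq']
    simp
  · refine sum_eq_zero fun q _ => sum_eq_zero fun ε _ => ?_
    simp [h]

/-- The degree of an S/N-type vertex, slice by slice. [folklore] -/
theorem deg_inr {m : ℕ} (M : Finset (E m)) (p : Fin m) (y : Fin (m + 1)) :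
    deg M (Sum.inr (p, y)) =
      ∑ q : Fin m, ∑ ε : Fin 2, if q.val + ε.val = y.val then
        ∑ δ : Fin 2, (if (δ, ε) ∈ slice M (p, q) then 1 else 0) else 0 := by
  classical
  rw [deg_eq_sum, Fintype.sum_prod_type, Fintype.sum_prod_type, sum_comm]
  refine sum_congr rfl fun q _ => ?_
  simp only [Inc, hEnd_ne_inr, false_or, vEnd_eq_inr_iff, Fintype.sum_prod_type, mem_slice]
  have hc : ∀ (δ ε : Fin 2), (∑ p' : Fin m,
      if ((p', q), (δ, ε)) ∈ M ∧ p' = p ∧ q.val + ε.val = y.val then (1 : ℕ) else 0)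
      = if ((p, q), (δ, ε)) ∈ M ∧ q.val + ε.val = y.val then 1 else 0 := by
    intro δ ε
    rw [Finset.sum_eq_single p]
    · simp
    · intro p' _ hp'; simp [hp']
    · simp
  calc (∑ p' : Fin m, ∑ δ : Fin 2, ∑ ε : Fin 2,
        if ((p', q), (δ, ε)) ∈ M ∧ p' = p ∧ q.val + ε.val = y.val then (1 : ℕ) else 0)
      = ∑ δ : Fin 2, ∑ ε : Fin 2, ∑ p' : Fin m,
          if ((p', q), (δ, ε)) ∈ M ∧ p' = p ∧ q.val + ε.val = y.val then (1 : ℕ) else 0 := by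
        rw [sum_comm]; exact sum_congr rfl fun δ _ => sum_comm
    _ = ∑ δ : Fin 2, ∑ ε : Fin 2, if ((p, q), (δ, ε)) ∈ M ∧ q.val + ε.val = y.val then 1 else 0 := by
        simp only [hc]
    _ = ∑ ε : Fin 2, ∑ δ : Fin 2, if ((p, q), (δ, ε)) ∈ M ∧ q.val + ε.val = y.val then 1 else 0 :=
        sum_comm
    _ = _ := by
        refine sum_congr rfl fun ε _ => ?_
        split_ifs with h
        · exact sum_congr rfl fun δ _ => by simp [h]
        · exact sum_eq_zero fun δ _ => by simp [h]

/-- In a local pattern each horizontal corner carries at most one edge. [folklore] -/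
theorem sum_indicator_fst_of_isLocal {P : Finset Pos} (hP : IsLocal P) (δ : Fin 2) :
    (∑ ε : Fin 2, if (δ, ε) ∈ P then 1 else 0) = if δ ∈ P.image Prod.fst then 1 else 0 := by
  classical
  rw [isLocal_iff] at hP
  split_ifs with h
  · obtain ⟨a, ha, rfl⟩ := mem_image.mp h
    rw [Finset.sum_eq_single a.2]
    · simp [ha]
    · intro ε _ hε
      rw [if_neg]
      intro hmem
      exact hε (congrArg Prod.snd (hP.1 hmem ha rfl))
    · simp
  · refine sum_eq_zero fun ε _ => ?_
    rw [if_neg]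
    intro hmem
    exact h (mem_image.mpr ⟨(δ, ε), hmem, rfl⟩)

/-- In a local pattern each vertical corner carries at most one edge. [folklore] -/
theorem sum_indicator_snd_of_isLocal {P : Finset Pos} (hP : IsLocal P) (ε : Fin 2) :
    (∑ δ : Fin 2, if (δ, ε) ∈ P then 1 else 0) = if ε ∈ P.image Prod.snd then 1 else 0 := by
  classical
  rw [isLocal_iff] at hP
  split_ifs with h
  · obtain ⟨a, ha, rfl⟩ := mem_image.mp h
    rw [Finset.sum_eq_single a.1]
    · simp [ha]
    · intro δ _ hδ
      rw [if_neg]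
      intro hmem
      exact hδ (congrArg Prod.fst (hP.2 hmem ha rfl))
    · simp
  · refine sum_eq_zero fun δ _ => ?_
    rw [if_neg]
    intro hmem
    exact h (mem_image.mpr ⟨(δ, ε), hmem, rfl⟩)

/-- If every slice is local, the degree is the boundary degree of the boundary types. [folklore] -/
theorem deg_eq_bdeg {m : ℕ} (M : Finset (E m)) (hM : ∀ c, IsLocal (slice M c)) (v : V m) :
    deg M v = bdeg (fun c => btype (slice M c)) v := by
  rcases v with ⟨x, y⟩ | ⟨p, y⟩
  · rw [deg_inl, bdeg]
    refine sum_congr rfl fun p _ => sum_congr rfl fun δ _ => ?_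
    rw [sum_indicator_fst_of_isLocal (hM (p, y)) δ, btype]
    by_cases h : p.val + δ.val = x.val <;> simp [h]
  · rw [deg_inr, bdeg]
    refine sum_congr rfl fun q _ => sum_congr rfl fun ε _ => ?_
    rw [sum_indicator_snd_of_isLocal (hM (p, q)) ε, btype]
    by_cases h : q.val + ε.val = y.val <;> simp [h]

/-- Two distinct edges at a vertex give degree at least two. [folklore] -/
theorem two_le_deg {m : ℕ} (M : Finset (E m)) (v : V m) {e₁ e₂ : E m} (hne : e₁ ≠ e₂)
    (h₁ : e₁ ∈ M) (h₂ : e₂ ∈ M) (hi₁ : Inc e₁ v) (hi₂ : Inc e₂ v) : 2 ≤ deg M v := by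
  classical
  unfold deg
  calc 2 = ({e₁, e₂} : Finset (E m)).card := (card_pair hne).symm
    _ ≤ _ := card_le_card (by
        intro e he
        simp only [mem_insert, mem_singleton] at he
        rcases he with rfl | rfl <;> simp [mem_filter, *])

/-- In a perfect matching every slice is local. [folklore] -/
theorem isLocal_slice_of_isPM {m : ℕ} {U : Finset (V m)} {M : Finset (E m)} (hM : IsPM U M)
    (c : Cell m) : IsLocal (slice M c) := by
  classical
  have hle : ∀ v, deg M v ≤ 1 := fun v => by rw [hM v]; split_ifs <;> simp
  rw [isLocal_iff]
  constructor
  · intro a ha b hb hab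
    by_contra hne
    simp only [mem_coe, mem_slice] at ha hb
    have h2 := two_le_deg M (hEnd (c, a)) (by simpa using hne) ha hb (Or.inl rfl)
      (Or.inl (by simp [hEnd, hab]))
    have h1 := hle (hEnd (c, a))
    omega
  · intro a ha b hb hab
    by_contra hne
    simp only [mem_coe, mem_slice] at ha hb
    have h2 := two_le_deg M (vEnd (c, a)) (by simpa using hne) ha hb (Or.inr rfl)
      (Or.inr (by simp [vEnd, hab]))
    have h1 := hle (vEnd (c, a))
    omega

/-- Perfect matchings are exactly the edge sets with local slices and consistent boundary types.
[cite: Propp2003, §5] -/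
theorem isPM_iff {m : ℕ} (U : Finset (V m)) (M : Finset (E m)) :
    IsPM U M ↔ (∀ c, IsLocal (slice M c)) ∧ Cons U (fun c => btype (slice M c)) := by
  constructor
  · intro hM
    refine ⟨isLocal_slice_of_isPM hM, fun v => ?_⟩
    rw [← deg_eq_bdeg M (isLocal_slice_of_isPM hM) v]
    exact hM v
  · rintro ⟨hloc, hcons⟩ v
    rw [deg_eq_bdeg M hloc v]
    exact hcons v

end

end SquareGridDimers

end Summit.ValiantsHypothesis.ValiantsHypothesis.Theorems
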